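import Mathlib
import Summits.QuantumFields.YangMills.Theses.FlowLineStateSpace
import Summits.QuantumFields.YangMills.Theorems.FlowLineStateSpaceEntropyNonConcentrationFromUI
import Summits.QuantumFields.YangMills.Theorems.FlowLineStateSpaceFlowMonotone
import Literature.MathematicalPhysics.QuantumLattice.TorusWilsonFlowExistence

/-!
# `FlowLineStateSpace.FlowedEnergyMeanBound` (item stmt-QuantumFields-14706) — proof

«Markov is free»: with `t₀(k) = inf{τ > 0 : τ² ⟨e_τ(0)⟩ ≥ 3/10}` (`t₀ > 0`), for every `k` and every
physical flow time `s > 0`: `min(s,1)² · E_k[t₀² e_k(s t₀, 0)] ≤ 3/10`.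

* `s < 1`: `τ = s t₀ < t₀` is not in the set (else `t₀ ≤ τ`), so `τ² ⟨e_τ⟩ < 3/10` — the definition of
  `t₀` as an infimum.
* `s ≥ 1`: `τ ↦ ⟨e_τ(0)⟩` is ANTITONE — by translation invariance of the torus Wilson measure and
  translation covariance of the flow (`integral_comp_flowedEnergy_translate`, file
  `…EntropyNonConcentrationFromUI`) `⟨e_τ(0)⟩ = |Λ|⁻¹ ⟨Σ_x e_τ(x)⟩`, and `Σ_x e_τ(x)` decreases along
  every flow line (Lüscher: the flow is the gradient flow of the Wilson action; general gauge group
  `H ⊆ U(N)`: `FlowLineStateSpaceFlowMonotone.antitone_sum_energyDensity`); and `τ ↦ τ²⟨e_τ(0)⟩` is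
  continuous (dominated convergence; flow lines are differentiable), so `t₀² ⟨e_{t₀}⟩ ≤ 3/10` at the
  infimum; hence `t₀² ⟨e_{s t₀}⟩ ≤ t₀² ⟨e_{t₀}⟩ ≤ 3/10`.

Main theorem: `Summit.QuantumFields.YangMills.Theorems.flowedEnergyMeanBound_proof`. Support item of
route FlowLineStateSpace; no crux, rung or summit is proved; the Yang–Mills mass gap is NOT proved.
-/

noncomputable section

open MeasureTheory Filter Topology Finset
open Literature.MathematicalPhysics.QuantumFieldTheory Literature.MathematicalPhysics.QuantumLattice
open Summit.QuantumFields.YangMills.Theorems.FlowLineStateSpaceEntropy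
open Summit.QuantumFields.YangMills.Theorems.FlowLineStateSpaceFlowMonotone

namespace Summit.QuantumFields.YangMills.Theorems

namespace FlowLineStateSpaceMeanBound

variable {G : Type} [Group G] [TopologicalSpace G]

/-- `range ρ ⊆ U(N)` for a lattice representation. -/
theorem range_subset_unitary (r : LatticeRep G) :
    ∀ A ∈ Set.range r.ρ, A ∈ Matrix.unitaryGroup (Fin r.N) ℂ := by
  rintro _ ⟨g, rfl⟩; exact r.mem_unitary g

/-- The tree's flow `τ ↦ wilsonFlowMatrix ρ τ U` IS a flow line of (1.4) from `ρ(U)` on the torus. -/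
theorem isWilsonFlowLine_wilsonFlowMatrix (r : LatticeRep G) {S : ℕ} [NeZero S]
    (U : GaugeConfig 4 S G) :
    IsWilsonFlowLine (Set.range r.ρ) (fun e => r.ρ (U e)) fun τ => wilsonFlowMatrix r.ρ τ U :=
  isWilsonFlowLine_matrixWilsonFlow
    (exists_isWilsonFlowLine_of_unitary (range_subset_unitary r) fun e => r.mem_unitary (U e))

/-- Pointwise monotonicity: `Σ_x E_{τ₂}(x)(U) ≤ Σ_x E_{τ₁}(x)(U)` for `τ₁ ≤ τ₂`. -/
theorem sum_flowedEnergy_antitone (r : LatticeRep G) {S : ℕ} [NeZero S] (U : GaugeConfig 4 S G)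
    {τ₁ τ₂ : ℝ} (h : τ₁ ≤ τ₂) :
    ∑ x : Site 4 S, flowedEnergy r.ρ τ₂ x U ≤ ∑ x : Site 4 S, flowedEnergy r.ρ τ₁ x U := by
  simp only [flowedEnergy_eq_energyDensity]
  exact sum_energyDensity_le_of_le (range_subset_unitary r) (isWilsonFlowLine_wilsonFlowMatrix r U) h

/-- Continuity in the flow time of `τ ↦ E_τ(x)(U)` (flow lines are differentiable). -/
theorem continuous_flowedEnergy_time (r : LatticeRep G) {S : ℕ} [NeZero S] (U : GaugeConfig 4 S G)
    (x : Site 4 S) : Continuous fun τ : ℝ => flowedEnergy r.ρ τ x U := by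
  have hΦ : Continuous fun τ : ℝ => wilsonFlowMatrix r.ρ τ U := by
    refine continuous_pi fun e => continuous_pi fun i => continuous_pi fun j => ?_
    exact continuous_iff_continuousAt.mpr fun τ =>
      ((isWilsonFlowLine_wilsonFlowMatrix r U).2 τ e i j).continuousAt
  simp only [flowedEnergy_eq_energyDensity]
  exact (continuous_energyDensity x).comp hΦ

end FlowLineStateSpaceMeanBound

open FlowLineStateSpaceMeanBound in
/-- **Item stmt-QuantumFields-14706 (`FlowLineStateSpace.FlowedEnergyMeanBound`).**
For every `k` and `s > 0`: `min(s,1)² · E_k[t₀(k)² e_k(s t₀(k), 0)] ≤ 3/10` — the `s < 1` half is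
the definition of `t₀` as a least crossing time; the `s ≥ 1` half is the monotone decay of
`τ ↦ ⟨e_τ(0)⟩` (gradient flow + translation invariance) and the attainment `t₀²⟨e_{t₀}⟩ ≤ 3/10`
(continuity). Support item only; no crux, rung or summit is proved. -/
theorem flowedEnergyMeanBound_proof :
    Summit.QuantumFields.YangMills.Theses.FlowLineStateSpace.FlowedEnergyMeanBound := by
  unfold Summit.QuantumFields.YangMills.Theses.FlowLineStateSpace.FlowedEnergyMeanBound
  intro G _ _ _ _ hG
  letI : MeasurableSpace G := borel G
  haveI : BorelSpace G := ⟨rfl⟩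
  intro r β L B hB μ e t0 ht0 ht0lim hL k s hs
  haveI : SecondCountableTopology G :=
    (r.continuous.isClosedEmbedding r.injective).isEmbedding.secondCountableTopology
  haveI : IsProbabilityMeasure (μ k) := isProbabilityMeasure_wilsonMeasure r.ρ r.continuous (β k)
  -- the density is the tree's flowed density
  have he : ∀ (τ : ℝ) (y : Site 4 (2 * L k + 1)) (U : GaugeConfig 4 (2 * L k + 1) G),
      e k τ y U = flowedEnergy r.ρ τ y U := fun τ y U =>
    density_eq_flowedEnergy r (hB k U) τ y
  have he0 : ∀ (τ : ℝ) (y : Site 4 (2 * L k + 1)) (U : GaugeConfig 4 (2 * L k + 1) G),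
      0 ≤ e k τ y U ∧ e k τ y U ≤ 64 * r.N := fun τ y U => density_bounds r (B k τ U) y
  have hcontU : ∀ (τ : ℝ) (y : Site 4 (2 * L k + 1)),
      Continuous fun U : GaugeConfig 4 (2 * L k + 1) G => e k τ y U := by
    intro τ y
    exact (continuous_density r (S := 2 * L k + 1) τ y).congr fun U => (he τ y U).symm
  have hint : ∀ (τ : ℝ) (y : Site 4 (2 * L k + 1)),
      Integrable (fun U : GaugeConfig 4 (2 * L k + 1) G => e k τ y U) (μ k) := fun τ y =>
    Integrable.of_bound (hcontU τ y).aestronglyMeasurable (64 * r.N)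
      (ae_of_all _ fun U => by
        obtain ⟨h0, h64⟩ := he0 τ y U
        rw [Real.norm_of_nonneg h0]; exact h64)
  -- the mean density `g`
  set g : ℝ → ℝ := fun τ => ∫ U, e k τ 0 U ∂μ k with hg
  have hg0 : ∀ τ, 0 ≤ g τ := fun τ => integral_nonneg fun U => (he0 τ 0 U).1
  -- (A) `g` is antitone
  have hg_anti : Antitone g := by
    intro τ₁ τ₂ hτ
    have hx : ∀ (τ : ℝ) (x : Site 4 (2 * L k + 1)), ∫ U, e k τ x U ∂μ k = g τ := by
      intro τ x
      have h := integral_comp_flowedEnergy_translate r.ρ (β k) τ x (fun v => v)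
      simp only [← he] at h
      exact h
    have hsum : ∀ τ : ℝ, ∫ U, ∑ x : Site 4 (2 * L k + 1), e k τ x U ∂μ k =
        (Fintype.card (Site 4 (2 * L k + 1)) : ℝ) * g τ := by
      intro τ
      rw [integral_finsetSum _ fun x _ => hint τ x]
      simp only [hx τ, sum_const, card_univ, nsmul_eq_mul]
    have hcard : (0 : ℝ) < Fintype.card (Site 4 (2 * L k + 1)) := by
      exact_mod_cast Fintype.card_pos
    have hmono : ∫ U, ∑ x : Site 4 (2 * L k + 1), e k τ₂ x U ∂μ k ≤
        ∫ U, ∑ x : Site 4 (2 * L k + 1), e k τ₁ x U ∂μ k := by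
      refine integral_mono (integrable_finsetSum _ fun x _ => hint τ₂ x)
        (integrable_finsetSum _ fun x _ => hint τ₁ x) fun U => ?_
      simp only [he]
      exact sum_flowedEnergy_antitone r U hτ
    rw [hsum, hsum] at hmono
    exact le_of_mul_le_mul_left hmono hcard
  -- (B) `g` is continuous
  have hg_cont : Continuous g := by
    refine continuous_of_dominated (bound := fun _ => 64 * (r.N : ℝ))
      (fun τ => (hcontU τ 0).aestronglyMeasurable) (fun τ => ae_of_all _ fun U => ?_)
      (integrable_const _) (ae_of_all _ fun U => ?_)
    · obtain ⟨h0, h64⟩ := he0 τ 0 U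
      rw [Real.norm_of_nonneg h0]; exact h64
    · have := continuous_flowedEnergy_time r U 0
      exact this.congr fun τ => (he τ 0 U).symm
  -- (C) below `t₀` the level `3/10` is not reached
  have hbdd : BddBelow {τ : ℝ | 0 < τ ∧ 3 / 10 ≤ τ ^ 2 * g τ} := ⟨0, fun τ hτ => hτ.1.le⟩
  have ht0def : t0 k = sInf {τ : ℝ | 0 < τ ∧ 3 / 10 ≤ τ ^ 2 * g τ} := rfl
  have hlt : ∀ τ : ℝ, 0 < τ → τ < t0 k → τ ^ 2 * g τ < 3 / 10 := by
    intro τ hτ0 hτlt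
    by_contra hge
    push Not at hge
    have := csInf_le hbdd ⟨hτ0, hge⟩
    rw [← ht0def] at this
    linarith
  have ht0pos := ht0 k
  -- the integral in the statement
  have hI : ∫ U, t0 k ^ 2 * e k (s * t0 k) 0 U ∂μ k = t0 k ^ 2 * g (s * t0 k) := by
    rw [hg]; exact integral_const_mul _ _
  rw [hI]
  rcases lt_or_ge s 1 with hs1 | hs1
  · -- `s < 1`: the definition of `t₀`
    rw [min_eq_left hs1.le]
    have h := hlt (s * t0 k) (by positivity) (by nlinarith)
    nlinarith [h]
  · -- `s ≥ 1`: monotonicity + attainment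
    rw [min_eq_right hs1, one_pow, one_mul]
    have hatt : t0 k ^ 2 * g (t0 k) ≤ 3 / 10 := by
      by_contra hgt
      push Not at hgt
      have hφ : Continuous fun τ : ℝ => τ ^ 2 * g τ := (continuous_pow 2).mul hg_cont
      have hev : ∀ᶠ τ in 𝓝 (t0 k), 3 / 10 < τ ^ 2 * g τ :=
        hφ.continuousAt.eventually (lt_mem_nhds hgt)
      obtain ⟨δ, hδ, hball⟩ := Metric.eventually_nhds_iff.mp hev
      set τ : ℝ := max (t0 k - δ / 2) (t0 k / 2) with hτ
      have hτpos : 0 < τ := lt_max_of_lt_right (by positivity)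
      have hτlt : τ < t0 k := max_lt (by linarith) (by linarith)
      have hτdist : dist τ (t0 k) < δ := by
        rw [Real.dist_eq, abs_sub_lt_iff]
        constructor <;> [linarith; linarith [le_max_left (t0 k - δ / 2) (t0 k / 2)]]
      have h1 := hball hτdist
      have h2 := hlt τ hτpos hτlt
      linarith
    have hmono : g (s * t0 k) ≤ g (t0 k) := hg_anti (by nlinarith)
    calc t0 k ^ 2 * g (s * t0 k) ≤ t0 k ^ 2 * g (t0 k) := by gcongr
      _ ≤ 3 / 10 := hatt

end Summit.QuantumFields.YangMills.Theorems

end
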